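import Mathlib
import Summits.Ventures.PercRepro2.CoinChainXAGateBridge
import Summits.Ventures.PercRepro2.CoinChainXATopGateFull
import Summits.Ventures.PercRepro2.CoinChainXAMjGateAlg

/-!
# The `mj` gate of the (j, j′) pair is a theorem of the chain
(blind cell PercRepro2, night-2 g30; §72.13)

For `ent = {m}`, any `ent' ∋ j, j'`, the entry markers and the principal-filter gate
`d' = d·1[{m, j} ⊆ W]` (the `mj` corner of §71.9), the cleared (XA′) holds: the general-gate bridge
`chain_XA'_gate_of_parts`, the gate sums (zero off the `m`-clusters, `νd·x` on them), the facts of the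
parts model — two new ones, `cg_fact_McM2` (the coin-entered `y`-marked clusters against the sure-entered
`x`-marked ones, from `hcd`) and `cg_fact_MM` (the sure-entered clusters among themselves, from `hdd`) —
and the 46-term certificate `cg_mj_full`.
-/

namespace Summit.Ventures.PercRepro2.Coin

open Classical

section MjFacts

variable {V : Type*} [DecidableEq V] {R : Type*} [Field R] [LinearOrder R] [IsStrictOrderedRing R]
variable (U ent ent' : Finset V) (ν c d : Finset V → R)
variable (hν0 : ∀ W, 0 ≤ ν W) (hν : ∀ s ⊆ U, ∀ t ⊆ U, ν s * ν t ≤ ν (s ∩ t) * ν (s ∪ t))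
  (hc0 : ∀ W, 0 ≤ c W) (hd0 : ∀ W, 0 ≤ d W) (hcd : ∀ s t, c s * d t ≤ c (s ∩ t) * d (s ∪ t))
  (hdd : ∀ s t, d s * d t ≤ d (s ∩ t) * d (s ∪ t))

include hν0 hν hc0 hd0 hcd in
/-- **The coin-entered `y`-marked clusters against the sure-entered `x`-marked ones** (`McM_xy`): the
join carries both markers. -/
theorem cg_fact_McM2 (x y : Finset V → R) (hx0 : ∀ W, 0 ≤ x W) (hy0 : ∀ W, 0 ≤ y W)
    (hxm : ∀ s t, x s ≤ x (s ∪ t)) (hym : ∀ s t, y s ≤ y (s ∪ t)) :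
    (∑ W ∈ U.powerset.filter (fun W => (¬ ∃ r ∈ ent, r ∈ W) ∧ ∃ r ∈ ent', r ∈ W), ν W * c W * y W)
      * (∑ W ∈ U.powerset.filter (fun W => ∃ r ∈ ent, r ∈ W), ν W * d W * x W) ≤
    (∑ W ∈ U.powerset.filter (fun W => ¬ ∃ r ∈ ent, r ∈ W), ν W * c W)
      * (∑ W ∈ U.powerset.filter (fun W => ∃ r ∈ ent, r ∈ W), ν W * d W * (x W * y W)) := by
  refine ad_sets_dec U (fun W => ν W * c W * y W) (fun W => ν W * d W * x W)
    (fun W => ν W * c W) (fun W => ν W * d W * (x W * y W))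
    (fun W => mul_nonneg (mul_nonneg (hν0 W) (hc0 W)) (hy0 W))
    (fun W => mul_nonneg (mul_nonneg (hν0 W) (hd0 W)) (hx0 W))
    (fun W => mul_nonneg (hν0 W) (hc0 W))
    (fun W => mul_nonneg (mul_nonneg (hν0 W) (hd0 W)) (mul_nonneg (hx0 W) (hy0 W)))
    (fun W => (¬ ∃ r ∈ ent, r ∈ W) ∧ ∃ r ∈ ent', r ∈ W) (fun W => ∃ r ∈ ent, r ∈ W)
    (fun W => ¬ ∃ r ∈ ent, r ∈ W) (fun W => ∃ r ∈ ent, r ∈ W) ?_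
  intro s hs t ht hA hB
  refine ⟨fun ⟨r, hr, hrW⟩ => hA.1 ⟨r, hr, (Finset.mem_inter.1 hrW).1⟩, ?_, ?_⟩
  · obtain ⟨r, hr, hrt⟩ := hB
    exact ⟨r, hr, Finset.mem_union.2 (Or.inr hrt)⟩
  · have hxt : x t ≤ x (s ∪ t) := by rw [Finset.union_comm]; exact hxm t s
    calc ν s * c s * y s * (ν t * d t * x t) = ((ν s * ν t) * (c s * d t)) * (x t * y s) := by ring
      _ ≤ ((ν (s ∩ t) * ν (s ∪ t)) * (c (s ∩ t) * d (s ∪ t))) * (x (s ∪ t) * y (s ∪ t)) :=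
          mul_le_mul (mul_le_mul (hν s hs t ht) (hcd s t) (mul_nonneg (hc0 s) (hd0 t))
            (mul_nonneg (hν0 _) (hν0 _)))
            (mul_le_mul hxt (hym s t) (hy0 s) (hx0 _)) (mul_nonneg (hx0 t) (hy0 s))
            (mul_nonneg (mul_nonneg (hν0 _) (hν0 _)) (mul_nonneg (hc0 _) (hd0 _)))
      _ = ν (s ∩ t) * c (s ∩ t) * (ν (s ∪ t) * d (s ∪ t) * (x (s ∪ t) * y (s ∪ t))) := by ring

include hν0 hν hd0 hdd in
/-- **The sure-entered clusters among themselves** (`MM`, single sure entry `m`): `d` log-supermodular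
on the `m`-clusters, which are closed under meets and joins. -/
theorem cg_fact_MM (m : V) (x y : Finset V → R) (hx0 : ∀ W, 0 ≤ x W) (hy0 : ∀ W, 0 ≤ y W)
    (hxm : ∀ s t, x s ≤ x (s ∪ t)) (hym : ∀ s t, y s ≤ y (s ∪ t)) :
    (∑ W ∈ U.powerset.filter (fun W => ∃ r ∈ ({m} : Finset V), r ∈ W), ν W * d W * x W)
      * (∑ W ∈ U.powerset.filter (fun W => ∃ r ∈ ({m} : Finset V), r ∈ W), ν W * d W * y W) ≤
    (∑ W ∈ U.powerset.filter (fun W => ∃ r ∈ ({m} : Finset V), r ∈ W), ν W * d W)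
      * (∑ W ∈ U.powerset.filter (fun W => ∃ r ∈ ({m} : Finset V), r ∈ W), ν W * d W * (x W * y W)) := by
  refine ad_sets_dec U (fun W => ν W * d W * x W) (fun W => ν W * d W * y W)
    (fun W => ν W * d W) (fun W => ν W * d W * (x W * y W))
    (fun W => mul_nonneg (mul_nonneg (hν0 W) (hd0 W)) (hx0 W))
    (fun W => mul_nonneg (mul_nonneg (hν0 W) (hd0 W)) (hy0 W))
    (fun W => mul_nonneg (hν0 W) (hd0 W))
    (fun W => mul_nonneg (mul_nonneg (hν0 W) (hd0 W)) (mul_nonneg (hx0 W) (hy0 W)))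
    (fun W => ∃ r ∈ ({m} : Finset V), r ∈ W) (fun W => ∃ r ∈ ({m} : Finset V), r ∈ W)
    (fun W => ∃ r ∈ ({m} : Finset V), r ∈ W) (fun W => ∃ r ∈ ({m} : Finset V), r ∈ W) ?_
  intro s hs t ht hA hB
  obtain ⟨r, hr, hrs⟩ := hA
  obtain ⟨r', hr', hrt⟩ := hB
  have hms : m ∈ s := Finset.mem_singleton.1 hr ▸ hrs
  have hmt : m ∈ t := Finset.mem_singleton.1 hr' ▸ hrt
  refine ⟨⟨m, Finset.mem_singleton_self m, Finset.mem_inter.2 ⟨hms, hmt⟩⟩,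
    ⟨m, Finset.mem_singleton_self m, Finset.mem_union.2 (Or.inl hms)⟩, ?_⟩
  have hyt : y t ≤ y (s ∪ t) := by rw [Finset.union_comm]; exact hym t s
  calc ν s * d s * x s * (ν t * d t * y t) = ((ν s * ν t) * (d s * d t)) * (x s * y t) := by ring
    _ ≤ ((ν (s ∩ t) * ν (s ∪ t)) * (d (s ∩ t) * d (s ∪ t))) * (x (s ∪ t) * y (s ∪ t)) :=
        mul_le_mul (mul_le_mul (hν s hs t ht) (hdd s t) (mul_nonneg (hd0 s) (hd0 t))
          (mul_nonneg (hν0 _) (hν0 _)))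
          (mul_le_mul (hxm s t) hyt (hy0 t) (hx0 _)) (mul_nonneg (hx0 s) (hy0 t))
          (mul_nonneg (mul_nonneg (hν0 _) (hν0 _)) (mul_nonneg (hd0 _) (hd0 _)))
    _ = ν (s ∩ t) * d (s ∩ t) * (ν (s ∪ t) * d (s ∪ t) * (x (s ∪ t) * y (s ∪ t))) := by ring

end MjFacts

section MjGateSums

variable {V : Type*} [DecidableEq V] {R : Type*} [Field R]
variable (U : Finset V) (m j : V) (ent' : Finset V) (ν d : Finset V → R)

/-- The `mj` gate vanishes on the clusters missing `m`. -/
theorem mj_gate_D (z : Finset V → R) :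
    ∑ W ∈ U.powerset.filter (fun W => (¬ ∃ r ∈ ({m} : Finset V), r ∈ W) ∧ ∃ r ∈ ent', r ∈ W), ν W * (if m ∈ W ∧ j ∈ W then d W else 0) * z W = 0 :=
  Finset.sum_eq_zero (fun W hW => by
    have h := (Finset.mem_filter.1 hW).2
    rw [if_neg (fun hmj => h.1 ⟨m, Finset.mem_singleton_self m, hmj.1⟩)]; ring)

/-- The `mj` gate vanishes on the clusters missing `m` (no marker). -/
theorem mj_gate_D' :
    ∑ W ∈ U.powerset.filter (fun W => (¬ ∃ r ∈ ({m} : Finset V), r ∈ W) ∧ ∃ r ∈ ent', r ∈ W), ν W * (if m ∈ W ∧ j ∈ W then d W else 0) = 0 :=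
  Finset.sum_eq_zero (fun W hW => by
    have h := (Finset.mem_filter.1 hW).2
    rw [if_neg (fun hmj => h.1 ⟨m, Finset.mem_singleton_self m, hmj.1⟩)]; ring)

/-- On the `m`-clusters the `mj` gate is `d·x`. -/
theorem mj_gate_M (x : Finset V → R) (hx : ∀ W, x W = if j ∈ W then 1 else 0) (z : Finset V → R) :
    ∑ W ∈ U.powerset.filter (fun W => ∃ r ∈ ({m} : Finset V), r ∈ W), ν W * (if m ∈ W ∧ j ∈ W then d W else 0) * z W =
      ∑ W ∈ U.powerset.filter (fun W => ∃ r ∈ ({m} : Finset V), r ∈ W), ν W * d W * x W * z W :=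
  Finset.sum_congr rfl (fun W hW => by
    obtain ⟨r, hr, hrW⟩ := (Finset.mem_filter.1 hW).2
    have hm : m ∈ W := Finset.mem_singleton.1 hr ▸ hrW
    rw [hx W]
    by_cases hj : j ∈ W
    · rw [if_pos ⟨hm, hj⟩, if_pos hj]; ring
    · rw [if_neg (fun h => hj h.2), if_neg hj]; ring)

/-- On the `m`-clusters the `mj` gate is `d·x` (no marker). -/
theorem mj_gate_M' (x : Finset V → R) (hx : ∀ W, x W = if j ∈ W then 1 else 0) :
    ∑ W ∈ U.powerset.filter (fun W => ∃ r ∈ ({m} : Finset V), r ∈ W), ν W * (if m ∈ W ∧ j ∈ W then d W else 0) =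
      ∑ W ∈ U.powerset.filter (fun W => ∃ r ∈ ({m} : Finset V), r ∈ W), ν W * d W * x W :=
  Finset.sum_congr rfl (fun W hW => by
    obtain ⟨r, hr, hrW⟩ := (Finset.mem_filter.1 hW).2
    have hm : m ∈ W := Finset.mem_singleton.1 hr ▸ hrW
    rw [hx W]
    by_cases hj : j ∈ W
    · rw [if_pos ⟨hm, hj⟩, if_pos hj]; ring
    · rw [if_neg (fun h => hj h.2), if_neg hj]; ring)

/-- An entry marker is idempotent. -/
theorem marker_sq (x : Finset V → R) (v : V) (hx : ∀ W, x W = if v ∈ W then 1 else 0) (W : Finset V) :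
    x W * x W = x W := by
  rw [hx W]; split_ifs <;> ring

end MjGateSums

section MjGateMain

variable {V : Type*} [DecidableEq V] {R : Type*} [Field R] [LinearOrder R] [IsStrictOrderedRing R]

set_option maxHeartbeats 1600000 in
/-- **THE `mj` GATE IS A THEOREM OF THE CHAIN**: for `ent = {m}`, any `ent' ∋ j, j'`, the entry markers
`x = 1[j ∈ ·]`, `y = 1[j' ∈ ·]` and the gate `d' = d·1[{m, j} ⊆ W]`, the cleared (XA′) holds under
`hν0`, `hν`, `hc0`, `hd0`, `hdc`, `hcd`, `hratio`, `hdd`. -/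
theorem chain_XA'_mj_gate (U : Finset V) (m j j' : V) (ent' : Finset V) (ν c d : Finset V → R)
    (hj : j ∈ ent') (hj' : j' ∈ ent')
    (hν0 : ∀ W, 0 ≤ ν W) (hν : ∀ s ⊆ U, ∀ t ⊆ U, ν s * ν t ≤ ν (s ∩ t) * ν (s ∪ t))
    (hc0 : ∀ W, 0 ≤ c W) (hd0 : ∀ W, 0 ≤ d W) (hdc : ∀ W, d W ≤ c W)
    (hcd : ∀ s t, c s * d t ≤ c (s ∩ t) * d (s ∪ t))
    (hratio : ∀ s t, s ⊆ t → d s * c t ≤ c s * d t)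
    (hdd : ∀ s t, d s * d t ≤ d (s ∩ t) * d (s ∪ t))
    (x y : Finset V → R) (hx : ∀ W, x W = if j ∈ W then 1 else 0) (hy : ∀ W, y W = if j' ∈ W then 1 else 0) :
    (((∑ W ∈ U.powerset, ν W * chainMix {m} ent' 0 c d W) * (∑ W ∈ U.powerset, ν W * chainMix {m} ent' 1 c d W * x W) - (∑ W ∈ U.powerset, ν W * chainMix {m} ent' 0 c d W * x W) * (∑ W ∈ U.powerset, ν W * chainMix {m} ent' 1 c d W)) *
          ((∑ W ∈ U.powerset, ν W * chainMix {m} ent' 0 c d W) * (∑ W ∈ U.powerset, ν W * chainMix {m} ent' 0 c (fun W => if m ∈ W ∧ j ∈ W then d W else 0) W * y W) - (∑ W ∈ U.powerset, ν W * chainMix {m} ent' 0 c d W * y W) * (∑ W ∈ U.powerset, ν W * chainMix {m} ent' 0 c (fun W => if m ∈ W ∧ j ∈ W then d W else 0) W))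
        + ((∑ W ∈ U.powerset, ν W * chainMix {m} ent' 0 c d W) * (∑ W ∈ U.powerset, ν W * chainMix {m} ent' 1 c d W * y W) - (∑ W ∈ U.powerset, ν W * chainMix {m} ent' 0 c d W * y W) * (∑ W ∈ U.powerset, ν W * chainMix {m} ent' 1 c d W)) *
          ((∑ W ∈ U.powerset, ν W * chainMix {m} ent' 0 c d W) * (∑ W ∈ U.powerset, ν W * chainMix {m} ent' 0 c (fun W => if m ∈ W ∧ j ∈ W then d W else 0) W * x W) - (∑ W ∈ U.powerset, ν W * chainMix {m} ent' 0 c d W * x W) * (∑ W ∈ U.powerset, ν W * chainMix {m} ent' 0 c (fun W => if m ∈ W ∧ j ∈ W then d W else 0) W))) ≤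
        (∑ W ∈ U.powerset, ν W * chainMix {m} ent' 0 c d W) * ((∑ W ∈ U.powerset, ν W * chainMix {m} ent' 0 c d W) * (∑ W ∈ U.powerset, ν W * chainMix {m} ent' 0 c d W) * (∑ W ∈ U.powerset, ν W * chainMix {m} ent' 1 c (fun W => if m ∈ W ∧ j ∈ W then d W else 0) W * (x W * y W))
          - (∑ W ∈ U.powerset, ν W * chainMix {m} ent' 0 c d W) * (∑ W ∈ U.powerset, ν W * chainMix {m} ent' 0 c d W * y W) * (∑ W ∈ U.powerset, ν W * chainMix {m} ent' 1 c (fun W => if m ∈ W ∧ j ∈ W then d W else 0) W * x W)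
          - (∑ W ∈ U.powerset, ν W * chainMix {m} ent' 0 c d W) * (∑ W ∈ U.powerset, ν W * chainMix {m} ent' 0 c d W * x W) * (∑ W ∈ U.powerset, ν W * chainMix {m} ent' 1 c (fun W => if m ∈ W ∧ j ∈ W then d W else 0) W * y W)
          + (∑ W ∈ U.powerset, ν W * chainMix {m} ent' 0 c d W * x W) * (∑ W ∈ U.powerset, ν W * chainMix {m} ent' 0 c d W * y W) * (∑ W ∈ U.powerset, ν W * chainMix {m} ent' 1 c (fun W => if m ∈ W ∧ j ∈ W then d W else 0) W)) := by
  have hx0 : ∀ W, 0 ≤ x W := fun W => by rw [hx W]; split_ifs <;> norm_num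
  have hy0 : ∀ W, 0 ≤ y W := fun W => by rw [hy W]; split_ifs <;> norm_num
  have hx1 : ∀ W, x W ≤ 1 := fun W => by rw [hx W]; split_ifs <;> norm_num
  have hy1 : ∀ W, y W ≤ 1 := fun W => by rw [hy W]; split_ifs <;> norm_num
  have hxm : ∀ s t, x s ≤ x (s ∪ t) := fun s t => by
    rw [hx s, hx (s ∪ t)]
    by_cases h : j ∈ s
    · rw [if_pos h, if_pos (Finset.mem_union_left t h)]
    · rw [if_neg h]; split_ifs <;> norm_num
  have hym : ∀ s t, y s ≤ y (s ∪ t) := fun s t => by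
    rw [hy s, hy (s ∪ t)]
    by_cases h : j' ∈ s
    · rw [if_pos h, if_pos (Finset.mem_union_left t h)]
    · rw [if_neg h]; split_ifs <;> norm_num
  have hxI : ∀ W, (¬ ∃ r ∈ ({m} : Finset V) ∪ ent', r ∈ W) → x W = 0 := fun W hW => by
    rw [hx W]; exact if_neg (fun h => hW ⟨j, Finset.mem_union.2 (Or.inr hj), h⟩)
  have hyI : ∀ W, (¬ ∃ r ∈ ({m} : Finset V) ∪ ent', r ∈ W) → y W = 0 := fun W hW => by
    rw [hy W]; exact if_neg (fun h => hW ⟨j', Finset.mem_union.2 (Or.inr hj'), h⟩)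
  refine chain_XA'_gate_of_parts U m j j' ent' ν c d (fun W => if m ∈ W ∧ j ∈ W then d W else 0) hj hj' x y hx hy ?_
  have eD0 := mj_gate_D' U m j ent' ν d
  have eDx := mj_gate_D U m j ent' ν d x
  have eDy := mj_gate_D U m j ent' ν d y
  have eDxy := mj_gate_D U m j ent' ν d (fun W => x W * y W)
  have eM0 := mj_gate_M' U m j ν d x hx
  have eMx := mj_gate_M U m j ν d x hx x
  have eMy := mj_gate_M U m j ν d x hx y
  have eMxy := mj_gate_M U m j ν d x hx (fun W => x W * y W)
  beta_reduce at eDxy eMxy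
  rw [eD0, eDx, eDy, eDxy, eM0, eMx, eMy, eMxy]
  have exx : ∑ W ∈ U.powerset.filter (fun W => ∃ r ∈ ({m} : Finset V), r ∈ W), ν W * d W * x W * x W = ∑ W ∈ U.powerset.filter (fun W => ∃ r ∈ ({m} : Finset V), r ∈ W), ν W * d W * x W :=
    Finset.sum_congr rfl (fun W _ => by rw [mul_assoc, marker_sq x j hx W])
  have exy : ∑ W ∈ U.powerset.filter (fun W => ∃ r ∈ ({m} : Finset V), r ∈ W), ν W * d W * x W * y W = ∑ W ∈ U.powerset.filter (fun W => ∃ r ∈ ({m} : Finset V), r ∈ W), ν W * d W * (x W * y W) :=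
    Finset.sum_congr rfl (fun W _ => by ring)
  have exxy : ∑ W ∈ U.powerset.filter (fun W => ∃ r ∈ ({m} : Finset V), r ∈ W), ν W * d W * x W * (x W * y W) = ∑ W ∈ U.powerset.filter (fun W => ∃ r ∈ ({m} : Finset V), r ∈ W), ν W * d W * (x W * y W) :=
    Finset.sum_congr rfl (fun W _ => by
      calc ν W * d W * x W * (x W * y W) = ν W * d W * ((x W * x W) * y W) := by ring
        _ = ν W * d W * (x W * y W) := by rw [marker_sq x j hx W])
  rw [exx, exy, exxy]
  -- the part sums
  set a := (∑ W ∈ U.powerset.filter (fun W => ¬ ∃ r ∈ ({m} : Finset V) ∪ ent', r ∈ W), ν W * c W) with ha_def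
  set δ := (∑ W ∈ U.powerset.filter (fun W => (¬ ∃ r ∈ ({m} : Finset V), r ∈ W) ∧ ∃ r ∈ ent', r ∈ W), ν W * (c W - d W)) with hδ_def
  set u := (∑ W ∈ U.powerset.filter (fun W => (¬ ∃ r ∈ ({m} : Finset V), r ∈ W) ∧ ∃ r ∈ ent', r ∈ W), ν W * d W) with hu_def
  set t := (∑ W ∈ U.powerset.filter (fun W => ∃ r ∈ ({m} : Finset V), r ∈ W), ν W * d W) with ht_def
  set XJ := (∑ W ∈ U.powerset.filter (fun W => (¬ ∃ r ∈ ({m} : Finset V), r ∈ W) ∧ ∃ r ∈ ent', r ∈ W), ν W * (c W - d W) * x W) with hXJ_def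
  set XU := (∑ W ∈ U.powerset.filter (fun W => (¬ ∃ r ∈ ({m} : Finset V), r ∈ W) ∧ ∃ r ∈ ent', r ∈ W), ν W * d W * x W) with hXU_def
  set XM := (∑ W ∈ U.powerset.filter (fun W => ∃ r ∈ ({m} : Finset V), r ∈ W), ν W * d W * x W) with hXM_def
  set YJ := (∑ W ∈ U.powerset.filter (fun W => (¬ ∃ r ∈ ({m} : Finset V), r ∈ W) ∧ ∃ r ∈ ent', r ∈ W), ν W * (c W - d W) * y W) with hYJ_def
  set YU := (∑ W ∈ U.powerset.filter (fun W => (¬ ∃ r ∈ ({m} : Finset V), r ∈ W) ∧ ∃ r ∈ ent', r ∈ W), ν W * d W * y W) with hYU_def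
  set YM := (∑ W ∈ U.powerset.filter (fun W => ∃ r ∈ ({m} : Finset V), r ∈ W), ν W * d W * y W) with hYM_def
  set XYM := (∑ W ∈ U.powerset.filter (fun W => ∃ r ∈ ({m} : Finset V), r ∈ W), ν W * d W * (x W * y W)) with hXYM_def
  have hcd0 : ∀ W, 0 ≤ c W - d W := fun W => by linarith [hdc W]
  have ha : 0 ≤ a := Finset.sum_nonneg (fun W _ => mul_nonneg (hν0 W) (hc0 W))
  have hδ : 0 ≤ δ := Finset.sum_nonneg (fun W _ => mul_nonneg (hν0 W) (hcd0 W))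
  have hu : 0 ≤ u := Finset.sum_nonneg (fun W _ => mul_nonneg (hν0 W) (hd0 W))
  have ht : 0 ≤ t := Finset.sum_nonneg (fun W _ => mul_nonneg (hν0 W) (hd0 W))
  have hXJ : 0 ≤ XJ := Finset.sum_nonneg (fun W _ => mul_nonneg (mul_nonneg (hν0 W) (hcd0 W)) (hx0 W))
  have hXU : 0 ≤ XU := Finset.sum_nonneg (fun W _ => mul_nonneg (mul_nonneg (hν0 W) (hd0 W)) (hx0 W))
  have hXM : 0 ≤ XM := Finset.sum_nonneg (fun W _ => mul_nonneg (mul_nonneg (hν0 W) (hd0 W)) (hx0 W))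
  have hYJ : 0 ≤ YJ := Finset.sum_nonneg (fun W _ => mul_nonneg (mul_nonneg (hν0 W) (hcd0 W)) (hy0 W))
  have hYU : 0 ≤ YU := Finset.sum_nonneg (fun W _ => mul_nonneg (mul_nonneg (hν0 W) (hd0 W)) (hy0 W))
  have hYM : 0 ≤ YM := Finset.sum_nonneg (fun W _ => mul_nonneg (mul_nonneg (hν0 W) (hd0 W)) (hy0 W))
  have hXYM : 0 ≤ XYM := Finset.sum_nonneg (fun W _ => mul_nonneg (mul_nonneg (hν0 W) (hd0 W)) (mul_nonneg (hx0 W) (hy0 W)))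
  have hXUu : XU ≤ u := Finset.sum_le_sum (fun W _ => mul_le_of_le_one_right (mul_nonneg (hν0 W) (hd0 W)) (hx1 W))
  have hXMt : XM ≤ t := Finset.sum_le_sum (fun W _ => mul_le_of_le_one_right (mul_nonneg (hν0 W) (hd0 W)) (hx1 W))
  have hYMt : YM ≤ t := Finset.sum_le_sum (fun W _ => mul_le_of_le_one_right (mul_nonneg (hν0 W) (hd0 W)) (hy1 W))
  have hXYMx : XYM ≤ XM := Finset.sum_le_sum (fun W _ => by
    calc ν W * d W * (x W * y W) = (ν W * d W * x W) * y W := by ring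
      _ ≤ ν W * d W * x W := mul_le_of_le_one_right (mul_nonneg (mul_nonneg (hν0 W) (hd0 W)) (hx0 W)) (hy1 W))
  -- the ideal carries no marker
  have hIx : (∑ W ∈ U.powerset.filter (fun W => ¬ ∃ r ∈ ({m} : Finset V) ∪ ent', r ∈ W), ν W * c W * x W) = 0 :=
    cgate_sum_zero U _ _ (fun W hW => by rw [hxI W hW, mul_zero])
  have hIy : (∑ W ∈ U.powerset.filter (fun W => ¬ ∃ r ∈ ({m} : Finset V) ∪ ent', r ∈ W), ν W * c W * y W) = 0 :=
    cgate_sum_zero U _ _ (fun W hW => by rw [hyI W hW, mul_zero])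
  -- the Holley facts
  have FJUx := cg_fact_JU' U {m} ent' ν c d hν0 hν hc0 hd0 hdc hcd hratio x hx0 hxm
  have FJMx := cg_fact_JM' U {m} ent' ν c d hν0 hν hc0 hd0 hdc hcd hratio x hx0 hxm
  have FJUy := cg_fact_JU' U {m} ent' ν c d hν0 hν hc0 hd0 hdc hcd hratio y hy0 hym
  rw [cg_entfree_piecewise U {m} ent' ν c d x, cg_entfree_piecewise' U {m} ent' ν c d, hIx, zero_add] at FJUx FJMx
  rw [cg_entfree_piecewise U {m} ent' ν c d y, cg_entfree_piecewise' U {m} ent' ν c d, hIy, zero_add] at FJUy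
  have FMx := cg_fact_McM U {m} ent' ν c d hν0 hν hc0 hd0 hcd x hx0 hxm
  have FMy := cg_fact_McM U {m} ent' ν c d hν0 hν hc0 hd0 hcd y hy0 hym
  have FM2 := cg_fact_McM2 U {m} ent' ν c d hν0 hν hc0 hd0 hcd x y hx0 hy0 hxm hym
  rw [sum_entfree_split U {m} ent' (fun W => ν W * c W), cg_split' U ν c d (fun W => (¬ ∃ r ∈ ({m} : Finset V), r ∈ W) ∧ ∃ r ∈ ent', r ∈ W), cg_split U ν c d (fun W => (¬ ∃ r ∈ ({m} : Finset V), r ∈ W) ∧ ∃ r ∈ ent', r ∈ W) x] at FMx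
  rw [sum_entfree_split U {m} ent' (fun W => ν W * c W), cg_split' U ν c d (fun W => (¬ ∃ r ∈ ({m} : Finset V), r ∈ W) ∧ ∃ r ∈ ent', r ∈ W), cg_split U ν c d (fun W => (¬ ∃ r ∈ ({m} : Finset V), r ∈ W) ∧ ∃ r ∈ ent', r ∈ W) y] at FMy
  rw [sum_entfree_split U {m} ent' (fun W => ν W * c W), cg_split' U ν c d (fun W => (¬ ∃ r ∈ ({m} : Finset V), r ∈ W) ∧ ∃ r ∈ ent', r ∈ W), cg_split U ν c d (fun W => (¬ ∃ r ∈ ({m} : Finset V), r ∈ W) ∧ ∃ r ∈ ent', r ∈ W) y] at FM2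
  -- the surviving-vs-sure-entered facts
  have FBx := cg_fact_BB U {m} ent' ν d hν0 hν hd0 hdd x hx0 hxm
  have FBy := cg_fact_BB U {m} ent' ν d hν0 hν hd0 hdd y hy0 hym
  have FB2 := cg_fact_BB2 U {m} ent' ν d hν0 hν hd0 hdd y x hy0 hx0 hym hxm
  have eyx : ∑ W ∈ U.powerset.filter (fun W => ∃ r ∈ ({m} : Finset V), r ∈ W), ν W * d W * (y W * x W) = XYM :=
    Finset.sum_congr rfl (fun W _ => by ring)
  rw [sum_entfree_split U {m} ent' (fun W => ν W * d W)] at FBx FBy FB2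
  rw [eyx] at FB2
  have hBI : (∑ W ∈ U.powerset.filter (fun W => ¬ ∃ r ∈ ({m} : Finset V) ∪ ent', r ∈ W), ν W * d W) ≤ a :=
    Finset.sum_le_sum (fun W _ => mul_le_mul_of_nonneg_left (hdc W) (hν0 W))
  have hBx : 0 ≤ XM * (a + u) - XU * t := by
    nlinarith [FBx, mul_le_mul_of_nonneg_right hBI hXM]
  have hBy : 0 ≤ YM * (a + u) - YU * t := by
    nlinarith [FBy, mul_le_mul_of_nonneg_right hBI hYM]
  have hBB2 : 0 ≤ XYM * (a + u) - YU * XM := by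
    nlinarith [FB2, mul_le_mul_of_nonneg_right hBI hXYM]
  have FMM := cg_fact_MM U ν d hν0 hν hd0 hdd m x y hx0 hy0 hxm hym
  -- the parts inequality
  have key := cg_mj_full a δ u t XJ XU XM YJ YU YM XYM ha hδ hu ht hXJ hXU hXM hYJ hYU hYM hXYM
    (by linear_combination FJUx) (by linear_combination FJMx) (by linear_combination FMx)
    (by linear_combination FJUy) (by linear_combination FMy) (by linear_combination FM2)
    hBx hBy hBB2 (by linear_combination FMM) (by linarith) (by linarith) (by linarith) (by linarith)
  linear_combination key

end MjGateMain

end Summit.Ventures.PercRepro2.Coin
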